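import Mathlib
import HarnessLib
import Summits.HubbardSuperconductivity.HubbardSuperconductivity.Theorems.KLProgrammeKLRegimeVolumeLimitFramedModulus

/-!
# VL children from POSITION-SPACE nested data ALONE (bare or framed): site kernel against the periodised site kernel of the nested volume,
# no first-moment hypothesis, no modulus (seat hubbard-kl-k3c5-p3 g6, technique «OS-positivity-free direct assembly»; `--supports` the VL child)

Route `KLProgramme`, crux K3, child VOLUME-LIMIT (`VolumeLimitP2 Pr FinalTwoLegVolLimitEx W`; gen 6: stmt-HubbardSuperconductivity-20239
`KLRegimeVolumeLimitV16`, skeleton «cauchy v5/v6»).  The position-space doors of this lineage (`carrierRateText_of_sitePeriodisation`,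
`volumeLimitP2_of_[framed]SitePeriodisationText`) took TWO inputs: (S) `ℓ¹` comparability of the site kernel `torusFourierInv (Σ̂_{L,M}(ω,·))` with the
PERIODISED site kernel of the nested volume `b·L` (same cutoff, same label), and (D) an `L`-uniform first centred site moment — (D) served only the
one-volume momentum modulus (M).  After `modulusText_holds` / `framedCarrierModulusText_holds` (this seat, p512141 / …FramedModulus) (D) is superfluous:

* `nestedText_of_sitePeriodisationText` / `framedNestedText_of_framedSitePeriodisationText` — (S) ⇒ the nested same-point comparability text (N)
  (bare frame, resp. the binders' frame `K`): Fourier inversion on each torus + exact periodisation of grid-sampled characters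
  (`norm_torusFourier_sub_torusFourier_of_latticeMomentum_eq`, …NestedPoisson);
* **`volumeLimitP2_of_sitePeriodisationOnlyText (Pr W) hPr hS`**, **`volumeLimitP2_of_framedSitePeriodisationOnlyText (Pr W) hS`** — a VL child of any
  generation from (S) ALONE.

Everything is proved; no definition.
-/

noncomputable section

namespace Summit.HubbardSuperconductivity.HubbardSuperconductivity.Theorems.TwoPointAssembly

set_option linter.dupNamespace false -- summit = problem name (single-conjunct summit), D-0017

open Finset Filter Topology Literature.MathematicalPhysics.QuantumLattice Literature.Probability.LatticeModels
open Literature.MathematicalPhysics.QuantumLattice.FermiRG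
open Summit.HubbardSuperconductivity.HubbardSuperconductivity.Theorems.DispersionFlow
open Summit.HubbardSuperconductivity.HubbardSuperconductivity.Theorems.KLRegimeSplit
open Summit.HubbardSuperconductivity.HubbardSuperconductivity.Theorems.KLProgrammeLegKernels

/-- **(S) ⇒ (N), bare frame**: `ℓ¹` comparability of the site kernel with the periodised site kernel of the nested volume gives nested same-point
comparability (Fourier inversion + exact periodisation of grid-sampled characters). -/
theorem nestedText_of_sitePeriodisationText (Pr : Preds) (W : Set ℝ)
    (hS : ∀ (G : GeoConsts) (P : SplitConsts) (Q : EngConsts) (R : RenConsts), G.WF → P.WF → Q.WF → R.WF →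
      ∃ c₅ : ℝ, 0 < c₅ ∧ ∀ c : ℝ, 0 < c → c ≤ c₅ → ∃ U₀ : ℝ, 0 < U₀ ∧
        ∀ μ ∈ W, ∀ U : ℝ, 0 < U → U ≤ U₀ → ∀ β : ℝ, klBetaMin ≤ β → β ≤ Real.exp (c / U ^ 2) →
          ∀ K : TrigPolyC4v, Pr.frameOK R U (nScales β) μ K →
            ∀ (Lstar : ℕ) (Mstar : ℕ → ℕ), TowerP Pr G P Q R β U μ K Lstar Mstar →
              ∃ L₀ : ℕ, ∃ ρ : ℕ → ℝ, Tendsto ρ atTop (𝓝 0) ∧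
                ∀ (L : ℕ) [NeZero L], L₀ ≤ L → ∀ (L'' : ℕ) [NeZero L''] (b : ℕ), L'' = b * L → ∃ M₀ : ℕ, ∀ (M : ℕ) [NeZero M], M₀ ≤ M →
                  ∀ ω : MatsubaraIdx M,
                    ∑ y : TorusSite 2 L,
                      ‖torusFourierInv (fun k : TorusSite 2 L => klSelfEnergy L M β U μ 0 klE0 (nScales β + 1) (ω, k) 0) y -
                        ∑ x ∈ Finset.univ.filter (fun x : TorusSite 2 L'' => (fun i => (((x i).val : ℕ) : ZMod L)) = y),
                          torusFourierInv (fun k : TorusSite 2 L'' => klSelfEnergy L'' M β U μ 0 klE0 (nScales β + 1) (ω, k) 0) x‖ ≤ ρ L) :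
    ∀ (G : GeoConsts) (P : SplitConsts) (Q : EngConsts) (R : RenConsts), G.WF → P.WF → Q.WF → R.WF →
      ∃ c₅ : ℝ, 0 < c₅ ∧ ∀ c : ℝ, 0 < c → c ≤ c₅ → ∃ U₀ : ℝ, 0 < U₀ ∧
        ∀ μ ∈ W, ∀ U : ℝ, 0 < U → U ≤ U₀ → ∀ β : ℝ, klBetaMin ≤ β → β ≤ Real.exp (c / U ^ 2) →
          ∀ K : TrigPolyC4v, Pr.frameOK R U (nScales β) μ K →
            ∀ (Lstar : ℕ) (Mstar : ℕ → ℕ), TowerP Pr G P Q R β U μ K Lstar Mstar →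
              ∃ L₀ : ℕ, ∃ ρ : ℕ → ℝ, Tendsto ρ atTop (𝓝 0) ∧
                ∀ (L : ℕ) [NeZero L], L₀ ≤ L → ∀ (L'' : ℕ) [NeZero L''], L ∣ L'' → ∃ M₀ : ℕ, ∀ (M : ℕ) [NeZero M], M₀ ≤ M →
                  ∀ (ω : MatsubaraIdx M) (k : TorusSite 2 L) (k'' : TorusSite 2 L''), latticeMomentum L'' k'' = latticeMomentum L k →
                    ‖klSelfEnergy L M β U μ 0 klE0 (nScales β + 1) (ω, k) 0 -
                        klSelfEnergy L'' M β U μ 0 klE0 (nScales β + 1) (ω, k'') 0‖ ≤ ρ L := by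
  intro G P Q R hG hP hQ hR
  obtain ⟨c₅, hc₅, hc⟩ := hS G P Q R hG hP hQ hR
  refine ⟨c₅, hc₅, fun c hc0 hcc => ?_⟩
  obtain ⟨U₀, hU₀, hU⟩ := hc c hc0 hcc
  refine ⟨U₀, hU₀, fun μ hμ U hU0 hUU β hβmin hβmax K hK Lstar Mstar hT => ?_⟩
  obtain ⟨L₀, ρ, hρ, hper⟩ := hU μ hμ U hU0 hUU β hβmin hβmax K hK Lstar Mstar hT
  refine ⟨L₀, ρ, hρ, fun L _ hL L'' _ hdvd => ?_⟩
  obtain ⟨b, hb⟩ := hdvd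
  have hM : L'' = b * L := hb.trans (mul_comm _ _)
  obtain ⟨M₀, hM₀⟩ := hper L hL L'' b hM
  refine ⟨M₀, fun M _ hMM ω k k'' hkk => ?_⟩
  rw [eq_torusFourier_torusFourierInv (fun k : TorusSite 2 L => klSelfEnergy L M β U μ 0 klE0 (nScales β + 1) (ω, k) 0) k,
    eq_torusFourier_torusFourierInv (fun k : TorusSite 2 L'' => klSelfEnergy L'' M β U μ 0 klE0 (nScales β + 1) (ω, k) 0) k'']
  exact (norm_torusFourier_sub_torusFourier_of_latticeMomentum_eq hM _ _ hkk).trans (hM₀ M hMM ω)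

/-- **(S) ⇒ (N) in the binders' frame `K`**. -/
theorem framedNestedText_of_framedSitePeriodisationText (Pr : Preds) (W : Set ℝ)
    (hS : ∀ (G : GeoConsts) (P : SplitConsts) (Q : EngConsts) (R : RenConsts), G.WF → P.WF → Q.WF → R.WF →
      ∃ c₅ : ℝ, 0 < c₅ ∧ ∀ c : ℝ, 0 < c → c ≤ c₅ → ∃ U₀ : ℝ, 0 < U₀ ∧
        ∀ μ ∈ W, ∀ U : ℝ, 0 < U → U ≤ U₀ → ∀ β : ℝ, klBetaMin ≤ β → β ≤ Real.exp (c / U ^ 2) →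
          ∀ K : TrigPolyC4v, Pr.frameOK R U (nScales β) μ K →
            ∀ (Lstar : ℕ) (Mstar : ℕ → ℕ), TowerP Pr G P Q R β U μ K Lstar Mstar →
              ∃ L₀ : ℕ, ∃ ρ : ℕ → ℝ, Tendsto ρ atTop (𝓝 0) ∧
                ∀ (L : ℕ) [NeZero L], L₀ ≤ L → ∀ (L'' : ℕ) [NeZero L''] (b : ℕ), L'' = b * L → ∃ M₀ : ℕ, ∀ (M : ℕ) [NeZero M], M₀ ≤ M →
                  ∀ ω : MatsubaraIdx M,
                    ∑ y : TorusSite 2 L,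
                      ‖torusFourierInv (fun k : TorusSite 2 L => klSelfEnergy L M β U μ K klE0 (nScales β + 1) (ω, k) 0) y -
                        ∑ x ∈ Finset.univ.filter (fun x : TorusSite 2 L'' => (fun i => (((x i).val : ℕ) : ZMod L)) = y),
                          torusFourierInv (fun k : TorusSite 2 L'' => klSelfEnergy L'' M β U μ K klE0 (nScales β + 1) (ω, k) 0) x‖ ≤ ρ L) :
    ∀ (G : GeoConsts) (P : SplitConsts) (Q : EngConsts) (R : RenConsts), G.WF → P.WF → Q.WF → R.WF →
      ∃ c₅ : ℝ, 0 < c₅ ∧ ∀ c : ℝ, 0 < c → c ≤ c₅ → ∃ U₀ : ℝ, 0 < U₀ ∧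
        ∀ μ ∈ W, ∀ U : ℝ, 0 < U → U ≤ U₀ → ∀ β : ℝ, klBetaMin ≤ β → β ≤ Real.exp (c / U ^ 2) →
          ∀ K : TrigPolyC4v, Pr.frameOK R U (nScales β) μ K →
            ∀ (Lstar : ℕ) (Mstar : ℕ → ℕ), TowerP Pr G P Q R β U μ K Lstar Mstar →
              ∃ L₀ : ℕ, ∃ ρ : ℕ → ℝ, Tendsto ρ atTop (𝓝 0) ∧
                ∀ (L : ℕ) [NeZero L], L₀ ≤ L → ∀ (L'' : ℕ) [NeZero L''], L ∣ L'' → ∃ M₀ : ℕ, ∀ (M : ℕ) [NeZero M], M₀ ≤ M →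
                  ∀ (ω : MatsubaraIdx M) (k : TorusSite 2 L) (k'' : TorusSite 2 L''), latticeMomentum L'' k'' = latticeMomentum L k →
                    ‖klSelfEnergy L M β U μ K klE0 (nScales β + 1) (ω, k) 0 -
                        klSelfEnergy L'' M β U μ K klE0 (nScales β + 1) (ω, k'') 0‖ ≤ ρ L := by
  intro G P Q R hG hP hQ hR
  obtain ⟨c₅, hc₅, hc⟩ := hS G P Q R hG hP hQ hR
  refine ⟨c₅, hc₅, fun c hc0 hcc => ?_⟩
  obtain ⟨U₀, hU₀, hU⟩ := hc c hc0 hcc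
  refine ⟨U₀, hU₀, fun μ hμ U hU0 hUU β hβmin hβmax K hK Lstar Mstar hT => ?_⟩
  obtain ⟨L₀, ρ, hρ, hper⟩ := hU μ hμ U hU0 hUU β hβmin hβmax K hK Lstar Mstar hT
  refine ⟨L₀, ρ, hρ, fun L _ hL L'' _ hdvd => ?_⟩
  obtain ⟨b, hb⟩ := hdvd
  have hM : L'' = b * L := hb.trans (mul_comm _ _)
  obtain ⟨M₀, hM₀⟩ := hper L hL L'' b hM
  refine ⟨M₀, fun M _ hMM ω k k'' hkk => ?_⟩
  rw [eq_torusFourier_torusFourierInv (fun k : TorusSite 2 L => klSelfEnergy L M β U μ K klE0 (nScales β + 1) (ω, k) 0) k,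
    eq_torusFourier_torusFourierInv (fun k : TorusSite 2 L'' => klSelfEnergy L'' M β U μ K klE0 (nScales β + 1) (ω, k) 0) k'']
  exact (norm_torusFourier_sub_torusFourier_of_latticeMomentum_eq hM _ _ hkk).trans (hM₀ M hMM ω)

/-- **A VL child (any `Pr`, `W`) from the bare POSITION-SPACE nested export ALONE** (no first site moment, no modulus). -/
theorem volumeLimitP2_of_sitePeriodisationOnlyText (Pr : Preds) (W : Set ℝ)
    (hPr : ∀ (R : RenConsts) (U : ℝ) (N : ℕ) (μ : ℝ) (K : TrigPolyC4v), Pr.frameOK R U N μ K → FrameOK R U N μ K)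
    (hS : ∀ (G : GeoConsts) (P : SplitConsts) (Q : EngConsts) (R : RenConsts), G.WF → P.WF → Q.WF → R.WF →
      ∃ c₅ : ℝ, 0 < c₅ ∧ ∀ c : ℝ, 0 < c → c ≤ c₅ → ∃ U₀ : ℝ, 0 < U₀ ∧
        ∀ μ ∈ W, ∀ U : ℝ, 0 < U → U ≤ U₀ → ∀ β : ℝ, klBetaMin ≤ β → β ≤ Real.exp (c / U ^ 2) →
          ∀ K : TrigPolyC4v, Pr.frameOK R U (nScales β) μ K →
            ∀ (Lstar : ℕ) (Mstar : ℕ → ℕ), TowerP Pr G P Q R β U μ K Lstar Mstar →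
              ∃ L₀ : ℕ, ∃ ρ : ℕ → ℝ, Tendsto ρ atTop (𝓝 0) ∧
                ∀ (L : ℕ) [NeZero L], L₀ ≤ L → ∀ (L'' : ℕ) [NeZero L''] (b : ℕ), L'' = b * L → ∃ M₀ : ℕ, ∀ (M : ℕ) [NeZero M], M₀ ≤ M →
                  ∀ ω : MatsubaraIdx M,
                    ∑ y : TorusSite 2 L,
                      ‖torusFourierInv (fun k : TorusSite 2 L => klSelfEnergy L M β U μ 0 klE0 (nScales β + 1) (ω, k) 0) y -
                        ∑ x ∈ Finset.univ.filter (fun x : TorusSite 2 L'' => (fun i => (((x i).val : ℕ) : ZMod L)) = y),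
                          torusFourierInv (fun k : TorusSite 2 L'' => klSelfEnergy L'' M β U μ 0 klE0 (nScales β + 1) (ω, k) 0) x‖ ≤ ρ L) :
    VolumeLimitP2 Pr FinalTwoLegVolLimitEx W :=
  volumeLimitP2_of_nestedOnlyText Pr W hPr (nestedText_of_sitePeriodisationText Pr W hS)

/-- **A VL child (any `Pr`, `W`) from the FRAMED POSITION-SPACE nested export ALONE** (the engine's own frame `K`; no frame-class hypothesis, no first
site moment, no modulus). -/
theorem volumeLimitP2_of_framedSitePeriodisationOnlyText (Pr : Preds) (W : Set ℝ)
    (hS : ∀ (G : GeoConsts) (P : SplitConsts) (Q : EngConsts) (R : RenConsts), G.WF → P.WF → Q.WF → R.WF →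
      ∃ c₅ : ℝ, 0 < c₅ ∧ ∀ c : ℝ, 0 < c → c ≤ c₅ → ∃ U₀ : ℝ, 0 < U₀ ∧
        ∀ μ ∈ W, ∀ U : ℝ, 0 < U → U ≤ U₀ → ∀ β : ℝ, klBetaMin ≤ β → β ≤ Real.exp (c / U ^ 2) →
          ∀ K : TrigPolyC4v, Pr.frameOK R U (nScales β) μ K →
            ∀ (Lstar : ℕ) (Mstar : ℕ → ℕ), TowerP Pr G P Q R β U μ K Lstar Mstar →
              ∃ L₀ : ℕ, ∃ ρ : ℕ → ℝ, Tendsto ρ atTop (𝓝 0) ∧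
                ∀ (L : ℕ) [NeZero L], L₀ ≤ L → ∀ (L'' : ℕ) [NeZero L''] (b : ℕ), L'' = b * L → ∃ M₀ : ℕ, ∀ (M : ℕ) [NeZero M], M₀ ≤ M →
                  ∀ ω : MatsubaraIdx M,
                    ∑ y : TorusSite 2 L,
                      ‖torusFourierInv (fun k : TorusSite 2 L => klSelfEnergy L M β U μ K klE0 (nScales β + 1) (ω, k) 0) y -
                        ∑ x ∈ Finset.univ.filter (fun x : TorusSite 2 L'' => (fun i => (((x i).val : ℕ) : ZMod L)) = y),
                          torusFourierInv (fun k : TorusSite 2 L'' => klSelfEnergy L'' M β U μ K klE0 (nScales β + 1) (ω, k) 0) x‖ ≤ ρ L) :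
    VolumeLimitP2 Pr FinalTwoLegVolLimitEx W :=
  volumeLimitP2_of_framedNestedOnlyText Pr W (framedNestedText_of_framedSitePeriodisationText Pr W hS)

end Summit.HubbardSuperconductivity.HubbardSuperconductivity.Theorems.TwoPointAssembly

end
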